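import Mathlib.Analysis.SpecialFunctions.Trigonometric.Deriv
import Mathlib.Analysis.SpecialFunctions.Trigonometric.Inverse
import Mathlib.Analysis.SpecialFunctions.SmoothTransition
import Mathlib.Analysis.SpecialFunctions.Sqrt
import Mathlib.Analysis.Calculus.Deriv.MeanValue
import Mathlib.Analysis.Calculus.ContDiff.RCLike
import Mathlib.Topology.Order.Compact
import HarnessLib

/-!
# The profile of Gompf's collar annulus: bend, flat sector and the foot of the cylinder

Plane geometry for the disc `D` of R. Gompf, *More Cappell–Shaneson spheres are standard*, Algebr.
Geom. Topol. 10 (2010), proof of Thm 2.1 ("let `F′` be the punctured torus obtained from `F` by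
connecting it to `N` using the obvious collar") in the straightened product model: near the
puncture `q₀` of the sphere `S` (`FishtailSection.lean`) the disc leaves the level `y = 0` of `S`
along a surface of revolution about `q₀`; its meridian profile in the half-plane
`(u, y)` (`u` the distance from `q₀` in the cap chart) is the horizontal ray `y = 0, u ≥ 3ρ`
(part of `S`), a bend, and the vertical ray `u = 2ρ, y ≥ ρ` (the cylinder of radius `2ρ`).
We take for the bend the **polar curve about `C = (3ρ, ρ)`** with radius `R(ψ)`
(`ψ` the angle from the downward vertical towards the left), `R = ρ / cos ψ` on the bottom sector
`ψ ≤ π/6` (the line `y = 0`), `R = ρ / sin ψ` on the left sector `ψ ≥ π/3` (the line `u = 2ρ`),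
blended in between; the shell of the tubular neighbourhood of `D` is displaced **radially towards
`C`** over the bend (trivially injective: polar coordinates about `C`), vertically over `S`, and
horizontally over the cylinder, with two interpolations on the straight parts:

* `Literature.Topology.FourManifolds.bendR`, `Literature.Topology.FourManifolds.bendPt ρ ψ a` —
  the bend and its radial shell; smoothness on `ψ ∈ (-π/6, 2π/3)`, bounds `ρ ≤ R ≤ 2ρ`,
  **injectivity** (`bendPt_inj`);
* `Literature.Topology.FourManifolds.flatPt ρ u₀ a` — the shell over the bottom line,
  interpolating from radial (`u₀ ≤ 5ρ/2`, where it *equals* the bend shell, `flatPt_eq_bendPt`)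
  to vertical (`u₀ ≥ 3ρ`, where it is `(u₀, a)`, matching the vertical family over `S`);
* `Literature.Topology.FourManifolds.footPt ρ y a` — the shell over the foot of the cylinder,
  interpolating from radial (`y ≤ 3ρ/2`, equal to the bend shell, `footPt_eq_bendPt`) to
  horizontal (`y ≥ 2ρ`, where it is `(2ρ + a, y)`);
* the interpolated shells are injective for small displacement by the elementary
  **perturbation-of-the-identity lemma** `Literature.Topology.FourManifolds.strictMonoOn_id_add_mul`
  (`u ↦ u + Y h(u)` is strictly increasing on a compact interval when `|Y| · sup |h′| < 1`),
  `exists_injOn_flatPt`, `exists_injOn_footPt`.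

Everything is proved; no named facts.

## References

* R. E. Gompf, *More Cappell–Shaneson spheres are standard*, Algebr. Geom. Topol. 10 (2010)
  1665–1681, proof of Thm 2.1 (`F′`, the collar `[1,2] × ∂F`) and Lemma 2.2. [GompfAGT2010]
-/

noncomputable section

open scoped Real ContDiff Topology
open Set Function Filter

namespace Literature.Topology.FourManifolds

/-! ### Perturbations of the identity on a compact interval -/

section Perturb

/-- **`u ↦ u + Y h(u)` is strictly increasing on `[a, b]` when `|Y| H < 1` and `|h′| ≤ H` there.** [folklore] -/
theorem strictMonoOn_id_add_mul {h : ℝ → ℝ} {a b H Y : ℝ} (hd : ∀ x ∈ Icc a b, DifferentiableAt ℝ h x)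
    (hH : ∀ x ∈ Icc a b, |deriv h x| ≤ H) (hY : |Y| * H < 1) :
    StrictMonoOn (fun u ↦ u + Y * h u) (Icc a b) := by
  refine strictMonoOn_of_deriv_pos (convex_Icc a b) ?_ fun x hx ↦ ?_
  · exact (continuousOn_id.add (continuousOn_const.mul fun x hx ↦ (hd x hx).continuousAt.continuousWithinAt))
  · rw [interior_Icc] at hx
    have hx' : x ∈ Icc a b := Ioo_subset_Icc_self hx
    have hdx := hd x hx'
    have hder : HasDerivAt (fun u ↦ u + Y * h u) (1 + Y * deriv h x) x :=
      (hasDerivAt_id' x).add (hdx.hasDerivAt.const_mul Y)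
    rw [hder.deriv]
    have h1 : |Y * deriv h x| ≤ |Y| * H := by
      rw [abs_mul]; exact mul_le_mul_of_nonneg_left (hH x hx') (abs_nonneg _)
    have h2 := neg_abs_le (Y * deriv h x)
    linarith

/-- **A `C¹` function has bounded derivative on a compact interval.** [folklore] -/
theorem exists_abs_deriv_le {h : ℝ → ℝ} {a b : ℝ} (hh : ∀ x ∈ Icc a b, ContDiffAt ℝ 1 h x) :
    ∃ H, 0 ≤ H ∧ ∀ x ∈ Icc a b, |deriv h x| ≤ H := by
  have hc : ContinuousOn (deriv h) (Icc a b) := fun x hx ↦ by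
    have h1 : ContinuousAt (fun y ↦ fderiv ℝ h y 1) x :=
      ((hh x hx).continuousAt_fderiv one_ne_zero).clm_apply continuousAt_const
    exact h1.continuousWithinAt
  obtain ⟨C, hC⟩ := isCompact_Icc.exists_bound_of_continuousOn hc
  exact ⟨max C 0, le_max_right _ _, fun x hx ↦ (hC x hx).trans (le_max_left _ _)⟩

/-- **Injectivity of an interpolated shell.** If `k ≥ k₀ > 0` and `h` are `C¹` on `[a, b]`, then
for small `|A|` the map `(u, A) ↦ (u + A h(u) k(u)⁻¹ …)` — here in the form: `u + Y h u` with
`Y` read off first — is injective; we record the form actually used: there is `δ > 0` such that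
`(u, A) ↦ (u + A p(u), A k(u))` is injective on `[a, b] × [-δ, δ]` provided `k ≥ k₀ > 0`,
with `p`, `k` of class `C¹`. [folklore] -/
theorem exists_injOn_interp {p k : ℝ → ℝ} {a b k₀ : ℝ} (hk₀ : 0 < k₀)
    (hp : ∀ x ∈ Icc a b, ContDiffAt ℝ 1 p x) (hk : ∀ x ∈ Icc a b, ContDiffAt ℝ 1 k x)
    (hkk : ∀ x ∈ Icc a b, k₀ ≤ k x) :
    ∃ δ > 0, InjOn (fun q : ℝ × ℝ ↦ (q.1 + q.2 * p q.1, q.2 * k q.1)) (Icc a b ×ˢ Icc (-δ) δ) := by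
  -- `h = p / k`
  have hkne : ∀ x ∈ Icc a b, k x ≠ 0 := fun x hx ↦ (hk₀.trans_le (hkk x hx)).ne'
  have hh : ∀ x ∈ Icc a b, ContDiffAt ℝ 1 (fun u ↦ p u / k u) x := fun x hx ↦ (hp x hx).div (hk x hx) (hkne x hx)
  obtain ⟨H, hH0, hH⟩ := exists_abs_deriv_le hh
  obtain ⟨K, hK⟩ := isCompact_Icc.exists_bound_of_continuousOn
    (fun x hx ↦ ((hk x hx).continuousAt).continuousWithinAt : ContinuousOn k (Icc a b))
  have hKpos : 0 < max K 1 := lt_max_of_lt_right one_pos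
  refine ⟨1 / (2 * (H + 1) * max K 1), by positivity, ?_⟩
  rintro ⟨u, A⟩ ⟨hu, hA⟩ ⟨u', A'⟩ ⟨hu', hA'⟩ heq
  simp only [Prod.mk.injEq] at heq ⊢
  obtain ⟨h1, h2⟩ := heq
  -- `Y = A k u = A' k u'`
  set Y := A * k u with hYdef
  have hAY : A = Y / k u := by rw [hYdef, mul_div_cancel_right₀ _ (hkne u hu)]
  have hAY' : A' = Y / k u' := by rw [h2, mul_div_cancel_right₀ _ (hkne u' hu')]
  have hYb : |Y| ≤ 1 / (2 * (H + 1)) := by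
    rw [hYdef, abs_mul]
    have hk' : |k u| ≤ max K 1 := ((Real.norm_eq_abs _).symm.le.trans (hK u hu)).trans (le_max_left _ _)
    have hA1 : |A| ≤ 1 / (2 * (H + 1) * max K 1) := abs_le.2 ⟨by linarith [hA.1], hA.2⟩
    calc |A| * |k u| ≤ 1 / (2 * (H + 1) * max K 1) * max K 1 :=
          mul_le_mul hA1 hk' (abs_nonneg _) (by positivity)
      _ = 1 / (2 * (H + 1)) := by field_simp
  have hYH : |Y| * H < 1 := by
    have : |Y| * H ≤ 1 / (2 * (H + 1)) * H := mul_le_mul_of_nonneg_right hYb hH0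
    have h3 : 1 / (2 * (H + 1)) * H < 1 := by
      rw [div_mul_eq_mul_div, one_mul, div_lt_one (by positivity)]; linarith
    linarith
  have hmono := strictMonoOn_id_add_mul (fun x hx ↦ (hh x hx).differentiableAt one_ne_zero) hH hYH
  have heq' : u + Y * (p u / k u) = u' + Y * (p u' / k u') := by
    have e1 : A * p u = Y * (p u / k u) := by rw [hAY]; field_simp
    have e2 : A' * p u' = Y * (p u' / k u') := by rw [hAY']; field_simp
    rw [← e1, ← e2]; exact h1
  have huu : u = u' := hmono.injOn hu hu' heq'
  refine ⟨huu, ?_⟩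
  rw [hAY, hAY', huu]

end Perturb

/-! ### The bend: a polar curve about `C = (3ρ, ρ)` -/

section Bend

variable (ρ : ℝ)

/-- The blending bump of the bend: `0` for `ψ ≤ π/6`, `1` for `ψ ≥ π/3`. [folklore] -/
def bendB (ψ : ℝ) : ℝ := Real.smoothTransition ((ψ - π / 6) / (π / 6))

/-- **The radius of the bend about `C`**: `ρ / cos ψ` (the bottom line `y = 0`) blended into
`ρ / sin ψ` (the left line `u = 2ρ`). [cite: GompfAGT2010, Thm 2.1 (proof: the collar [1,2] × ∂F connecting F to N)] -/
def bendR (ψ : ℝ) : ℝ := (1 - bendB ψ) * (ρ / Real.cos ψ) + bendB ψ * (ρ / Real.sin ψ)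

/-- **The radial shell of the bend**: the point at angle `ψ` (from the downward vertical at `C`,
towards the left) displaced by `a` towards `C`: `C - (R(ψ) - a)(sin ψ, cos ψ)`. [folklore] -/
def bendPt (ψ a : ℝ) : ℝ × ℝ := (3 * ρ - (bendR ρ ψ - a) * Real.sin ψ, ρ - (bendR ρ ψ - a) * Real.cos ψ)

variable {ρ}

/-- `bendB_of_le`. [folklore] -/
theorem bendB_of_le {ψ : ℝ} (h : ψ ≤ π / 6) : bendB ψ = 0 :=
  Real.smoothTransition.zero_of_nonpos (div_nonpos_of_nonpos_of_nonneg (by linarith) (by positivity))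

/-- `bendB_of_ge`. [folklore] -/
theorem bendB_of_ge {ψ : ℝ} (h : π / 3 ≤ ψ) : bendB ψ = 1 :=
  Real.smoothTransition.one_of_one_le (by rw [le_div_iff₀ (by positivity)]; linarith)

/-- `bendB_mem`. [folklore] -/
theorem bendB_mem (ψ : ℝ) : bendB ψ ∈ Icc (0 : ℝ) 1 :=
  ⟨Real.smoothTransition.nonneg _, Real.smoothTransition.le_one _⟩

/-- `contDiff_bendB`. [folklore] -/
theorem contDiff_bendB : ContDiff ℝ ∞ bendB :=
  Real.smoothTransition.contDiff.comp ((contDiff_id.sub contDiff_const).div_const _)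

/-- On the bottom sector the radius is `ρ / cos ψ`. [folklore] -/
theorem bendR_of_le {ψ : ℝ} (h : ψ ≤ π / 6) : bendR ρ ψ = ρ / Real.cos ψ := by
  rw [bendR, bendB_of_le h]; ring

/-- On the left sector the radius is `ρ / sin ψ`. [folklore] -/
theorem bendR_of_ge {ψ : ℝ} (h : π / 3 ≤ ψ) : bendR ρ ψ = ρ / Real.sin ψ := by
  rw [bendR, bendB_of_ge h]; ring

/-- `cos ψ > 1/2 ≥ …` bounds on the working range. [folklore] -/
theorem cos_pos_of_mem {ψ : ℝ} (h1 : -(π / 6) < ψ) (h2 : ψ < π / 2) : 0 < Real.cos ψ :=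
  Real.cos_pos_of_mem_Ioo ⟨by linarith [Real.pi_pos], h2⟩

/-- `sin_pos_of_mem`. [folklore] -/
theorem sin_pos_of_mem {ψ : ℝ} (h1 : 0 < ψ) (h2 : ψ < 2 * π / 3) : 0 < Real.sin ψ :=
  Real.sin_pos_of_pos_of_lt_pi h1 (by linarith [Real.pi_pos])

/-- `cos ψ ≥ 1/2` for `|ψ| ≤ π/3`. [folklore] -/
theorem half_le_cos {ψ : ℝ} (h1 : -(π / 3) ≤ ψ) (h2 : ψ ≤ π / 3) : 1 / 2 ≤ Real.cos ψ := by
  rw [← Real.cos_pi_div_three, ← Real.cos_abs ψ]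
  exact Real.cos_le_cos_of_nonneg_of_le_pi (abs_nonneg _) (by linarith [Real.pi_pos]) (abs_le.2 ⟨h1, h2⟩)

/-- `sin ψ ≥ 1/2` for `π/6 ≤ ψ ≤ 5π/6`. [folklore] -/
theorem half_le_sin {ψ : ℝ} (h1 : π / 6 ≤ ψ) (h2 : ψ ≤ 5 * π / 6) : 1 / 2 ≤ Real.sin ψ := by
  rw [← Real.cos_pi_div_two_sub, ← Real.cos_pi_div_three, ← Real.cos_abs (π / 2 - ψ)]
  exact Real.cos_le_cos_of_nonneg_of_le_pi (abs_nonneg _) (by linarith [Real.pi_pos])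
    (abs_le.2 ⟨by linarith, by linarith⟩)

variable (hρ : 0 < ρ)
include hρ

/-- **`ρ ≤ R(ψ) ≤ 2ρ` on `-π/6 < ψ < 2π/3`.** [folklore] -/
theorem bendR_mem {ψ : ℝ} (h1 : -(π / 6) < ψ) (h2 : ψ < 2 * π / 3) : bendR ρ ψ ∈ Icc ρ (2 * ρ) := by
  have hb := bendB_mem ψ
  have hπ := Real.pi_pos
  rcases le_or_gt ψ (π / 6) with hlo | hlo
  · rw [bendR_of_le hlo]
    have hc := half_le_cos (ψ := ψ) (by linarith) (by linarith)
    have hc1 := Real.cos_le_one ψ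
    have hcpos : 0 < Real.cos ψ := by linarith
    constructor
    · rw [le_div_iff₀ hcpos]; nlinarith
    · rw [div_le_iff₀ hcpos]; nlinarith
  rcases le_or_gt (π / 3) ψ with hhi | hhi
  · rw [bendR_of_ge hhi]
    have hs := half_le_sin (ψ := ψ) (by linarith) (by linarith)
    have hs1 := Real.sin_le_one ψ
    have hspos : 0 < Real.sin ψ := by linarith
    constructor
    · rw [le_div_iff₀ hspos]; nlinarith
    · rw [div_le_iff₀ hspos]; nlinarith
  · -- blend zone: both terms in `[ρ, 2ρ]`
    have hc := half_le_cos (ψ := ψ) (by linarith) hhi.le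
    have hs := half_le_sin (ψ := ψ) hlo.le (by linarith)
    have hc1 := Real.cos_le_one ψ
    have hs1 := Real.sin_le_one ψ
    have hcpos : 0 < Real.cos ψ := by linarith
    have hspos : 0 < Real.sin ψ := by linarith
    have t1 : ρ / Real.cos ψ ∈ Icc ρ (2 * ρ) :=
      ⟨by rw [le_div_iff₀ hcpos]; nlinarith, by rw [div_le_iff₀ hcpos]; nlinarith⟩
    have t2 : ρ / Real.sin ψ ∈ Icc ρ (2 * ρ) :=
      ⟨by rw [le_div_iff₀ hspos]; nlinarith, by rw [div_le_iff₀ hspos]; nlinarith⟩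
    rw [bendR]
    constructor <;> nlinarith [hb.1, hb.2, t1.1, t1.2, t2.1, t2.2]

omit hρ in
/-- **The bend radius is smooth on `-π/6 < ψ < 2π/3`.** [folklore] -/
theorem contDiffAt_bendR {ψ : ℝ} (h1 : -(π / 6) < ψ) (h2 : ψ < 2 * π / 3) : ContDiffAt ℝ ∞ (bendR ρ) ψ := by
  have hπ := Real.pi_pos
  have hcos : ∀ {x : ℝ}, -(π / 6) < x → x < π / 2 → ContDiffAt ℝ ∞ (fun x ↦ ρ / Real.cos x) x :=
    fun hx1 hx2 ↦ contDiffAt_const.div Real.contDiff_cos.contDiffAt (cos_pos_of_mem hx1 hx2).ne'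
  have hsin : ∀ {x : ℝ}, 0 < x → x < 2 * π / 3 → ContDiffAt ℝ ∞ (fun x ↦ ρ / Real.sin x) x :=
    fun hx1 hx2 ↦ contDiffAt_const.div Real.contDiff_sin.contDiffAt (sin_pos_of_mem hx1 hx2).ne'
  rcases lt_or_ge ψ (π / 6) with hlo | hlo
  · -- locally `ρ / cos`
    have hev : bendR ρ =ᶠ[𝓝 ψ] fun x ↦ ρ / Real.cos x := by
      filter_upwards [(isOpen_lt continuous_id continuous_const).mem_nhds hlo] with x hx
      exact bendR_of_le hx.le
    exact (hcos h1 (by linarith)).congr_of_eventuallyEq hev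
  rcases lt_or_ge (π / 3) ψ with hhi | hhi
  · have hev : bendR ρ =ᶠ[𝓝 ψ] fun x ↦ ρ / Real.sin x := by
      filter_upwards [(isOpen_lt continuous_const continuous_id).mem_nhds hhi] with x hx
      exact bendR_of_ge hx.le
    exact (hsin (by linarith) h2).congr_of_eventuallyEq hev
  · unfold bendR
    exact ((contDiff_const.sub contDiff_bendB).contDiffAt.mul (hcos (by linarith) (by linarith))).add
      (contDiff_bendB.contDiffAt.mul (hsin (by linarith) (by linarith)))

omit hρ in
/-- The bend shell is smooth in `(ψ, a)` on the working range. [folklore] -/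
theorem contDiffAt_bendPt {q : ℝ × ℝ} (h1 : -(π / 6) < q.1) (h2 : q.1 < 2 * π / 3) :
    ContDiffAt ℝ ∞ (fun q : ℝ × ℝ ↦ bendPt ρ q.1 q.2) q := by
  have hR : ContDiffAt ℝ ∞ (fun q : ℝ × ℝ ↦ bendR ρ q.1) q := (contDiffAt_bendR h1 h2).comp q contDiffAt_fst
  unfold bendPt
  exact (contDiffAt_const.sub ((hR.sub contDiffAt_snd).mul (Real.contDiff_sin.contDiffAt.comp q contDiffAt_fst))).prodMk
    (contDiffAt_const.sub ((hR.sub contDiffAt_snd).mul (Real.contDiff_cos.contDiffAt.comp q contDiffAt_fst)))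

/-- **Injectivity of the radial shell of the bend** (polar coordinates about `C`): on
`-π/6 < ψ < 2π/3`, `|a| < ρ`. [folklore] -/
theorem bendPt_inj {ψ ψ' a a' : ℝ} (h1 : -(π / 6) < ψ) (h2 : ψ < 2 * π / 3) (h1' : -(π / 6) < ψ')
    (h2' : ψ' < 2 * π / 3) (ha : |a| < ρ) (ha' : |a'| < ρ) (h : bendPt ρ ψ a = bendPt ρ ψ' a') :
    ψ = ψ' ∧ a = a' := by
  have hR := bendR_mem hρ h1 h2
  have hR' := bendR_mem hρ h1' h2'
  set r := bendR ρ ψ - a with hr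
  set r' := bendR ρ ψ' - a' with hr'
  have hrpos : 0 < r := by have := (abs_lt.1 ha).2; rw [hr]; linarith [hR.1]
  have hrpos' : 0 < r' := by have := (abs_lt.1 ha').2; rw [hr']; linarith [hR'.1]
  simp only [bendPt, Prod.mk.injEq] at h
  obtain ⟨hs, hc⟩ := h
  have e1 : r * Real.sin ψ = r' * Real.sin ψ' := by linarith
  have e2 : r * Real.cos ψ = r' * Real.cos ψ' := by linarith
  have hrr : r = r' := by
    have hsq : r ^ 2 = r' ^ 2 := by
      calc r ^ 2 = (r * Real.sin ψ) ^ 2 + (r * Real.cos ψ) ^ 2 := by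
            linear_combination (-r ^ 2) * Real.sin_sq_add_cos_sq ψ
        _ = (r' * Real.sin ψ') ^ 2 + (r' * Real.cos ψ') ^ 2 := by rw [e1, e2]
        _ = r' ^ 2 := by linear_combination (r' ^ 2) * Real.sin_sq_add_cos_sq ψ'
    nlinarith
  have hsin : Real.sin ψ = Real.sin ψ' := by rw [← hrr] at e1; exact mul_left_cancel₀ hrpos.ne' e1
  have hcos : Real.cos ψ = Real.cos ψ' := by rw [← hrr] at e2; exact mul_left_cancel₀ hrpos.ne' e2
  have hψ : ψ = ψ' := by
    have hc1 : Real.cos (ψ - ψ') = 1 := by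
      rw [Real.cos_sub, hsin, hcos]; linear_combination Real.sin_sq_add_cos_sq ψ'
    have hπ := Real.pi_pos
    have := (Real.cos_eq_one_iff_of_lt_of_lt (by linarith) (by linarith)).1 hc1
    linarith
  refine ⟨hψ, ?_⟩
  have : bendR ρ ψ = bendR ρ ψ' := by rw [hψ]
  linarith [show r = r' from hrr]

omit hρ in
/-- **On the bottom sector the shell is the bottom line displaced by `a (sin ψ, cos ψ)`**:
`bendPt ψ a = (3ρ - ρ tan ψ + a sin ψ, a cos ψ)`. [folklore] -/
theorem bendPt_of_le {ψ : ℝ} (h0 : -(π / 6) < ψ) (h : ψ ≤ π / 6) (a : ℝ) :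
    bendPt ρ ψ a = (3 * ρ - ρ * Real.tan ψ + a * Real.sin ψ, a * Real.cos ψ) := by
  have hc : Real.cos ψ ≠ 0 := (cos_pos_of_mem h0 (by linarith [Real.pi_pos])).ne'
  rw [bendPt, bendR_of_le h, Real.tan_eq_sin_div_cos]
  refine Prod.ext ?_ ?_ <;> simp only <;> field_simp <;> ring

omit hρ in
/-- **On the left sector the shell is the left line displaced by `a (sin ψ, cos ψ)`**:
`bendPt ψ a = (2ρ + a sin ψ, ρ - ρ cos ψ / sin ψ + a cos ψ)`. [folklore] -/
theorem bendPt_of_ge {ψ : ℝ} (h : π / 3 ≤ ψ) (h2 : ψ < 2 * π / 3) (a : ℝ) :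
    bendPt ρ ψ a = (2 * ρ + a * Real.sin ψ, ρ - ρ * (Real.cos ψ / Real.sin ψ) + a * Real.cos ψ) := by
  have hs : Real.sin ψ ≠ 0 := (sin_pos_of_mem (by linarith [Real.pi_pos]) h2).ne'
  rw [bendPt, bendR_of_ge h]
  refine Prod.ext ?_ ?_ <;> simp only <;> field_simp <;> ring

/-- The bend stays in `u > 0` for `|a| < ρ` (indeed `u ≥ ρ - |a|`). [folklore] -/
theorem bendPt_fst_pos {ψ a : ℝ} (h1 : -(π / 6) < ψ) (h2 : ψ < 2 * π / 3) (ha : |a| < ρ) :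
    0 < (bendPt ρ ψ a).1 := by
  have hR := bendR_mem hρ h1 h2
  have hs := Real.sin_le_one ψ
  have hs' := Real.neg_one_le_sin ψ
  have ha' := abs_lt.1 ha
  show 0 < 3 * ρ - (bendR ρ ψ - a) * Real.sin ψ
  have hpos : 0 < bendR ρ ψ - a := by linarith [hR.1]
  nlinarith [hR.2]

end Bend

/-! ### The flat sector: from radial to vertical displacement over the bottom line -/

section Flat

variable (ρ : ℝ)

/-- The interpolation bump of the flat sector: `1` for `u₀ ≤ 5ρ/2` (radial), `0` for `u₀ ≥ 3ρ`
(vertical). [folklore] -/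
def flatM (u₀ : ℝ) : ℝ := 1 - Real.smoothTransition ((u₀ - 5 * ρ / 2) / (ρ / 2))

/-- The distance from `(u₀, 0)` to `C`. [folklore] -/
def flatD (u₀ : ℝ) : ℝ := Real.sqrt ((3 * ρ - u₀) ^ 2 + ρ ^ 2)

/-- Horizontal component of the inward unit direction towards `C`. [folklore] -/
def flatP (u₀ : ℝ) : ℝ := (3 * ρ - u₀) / flatD ρ u₀

/-- Vertical component of the inward unit direction towards `C`. [folklore] -/
def flatQ (u₀ : ℝ) : ℝ := ρ / flatD ρ u₀

/-- The horizontal displacement coefficient `m p`. [folklore] -/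
def flatPc (u₀ : ℝ) : ℝ := flatM ρ u₀ * flatP ρ u₀

/-- The vertical displacement coefficient `(1 - m) + m q`. [folklore] -/
def flatKc (u₀ : ℝ) : ℝ := (1 - flatM ρ u₀) + flatM ρ u₀ * flatQ ρ u₀

/-- **The shell over the bottom line**: `(u₀ + a m p, a ((1 - m) + m q))`. [folklore] -/
def flatPt (u₀ a : ℝ) : ℝ × ℝ := (u₀ + a * flatPc ρ u₀, a * flatKc ρ u₀)

variable {ρ} (hρ : 0 < ρ)

/-- `flatM_of_le`. [folklore] -/
theorem flatM_of_le (hρ : 0 < ρ) {u₀ : ℝ} (h : u₀ ≤ 5 * ρ / 2) : flatM ρ u₀ = 1 := by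
  rw [flatM, Real.smoothTransition.zero_of_nonpos (div_nonpos_of_nonpos_of_nonneg (by linarith) (by linarith)),
    sub_zero]

/-- `flatM_of_ge`. [folklore] -/
theorem flatM_of_ge (hρ : 0 < ρ) {u₀ : ℝ} (h : 3 * ρ ≤ u₀) : flatM ρ u₀ = 0 := by
  rw [flatM, Real.smoothTransition.one_of_one_le (by rw [le_div_iff₀ (by linarith)]; linarith), sub_self]

/-- `flatM_mem`. [folklore] -/
theorem flatM_mem (u₀ : ℝ) : flatM ρ u₀ ∈ Icc (0 : ℝ) 1 := by
  constructor
  · rw [flatM]; linarith [Real.smoothTransition.le_one ((u₀ - 5 * ρ / 2) / (ρ / 2))]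
  · rw [flatM]; linarith [Real.smoothTransition.nonneg ((u₀ - 5 * ρ / 2) / (ρ / 2))]

/-- `contDiff_flatM`. [folklore] -/
theorem contDiff_flatM : ContDiff ℝ ∞ (flatM ρ) :=
  contDiff_const.sub (Real.smoothTransition.contDiff.comp ((contDiff_id.sub contDiff_const).div_const _))

include hρ

/-- `flatD_pos`. [folklore] -/
theorem flatD_pos (u₀ : ℝ) : 0 < flatD ρ u₀ := Real.sqrt_pos.2 (by positivity)

/-- `contDiff_flatD`. [folklore] -/
theorem contDiff_flatD : ContDiff ℝ ∞ (flatD ρ) :=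
  ((contDiff_const.sub contDiff_id).pow 2 |>.add contDiff_const).sqrt fun u₀ ↦ by positivity

/-- `contDiff_flatPc`. [folklore] -/
theorem contDiff_flatPc : ContDiff ℝ ∞ (flatPc ρ) :=
  contDiff_flatM.mul ((contDiff_const.sub contDiff_id).div (contDiff_flatD hρ) fun u ↦ (flatD_pos hρ u).ne')

/-- `contDiff_flatKc`. [folklore] -/
theorem contDiff_flatKc : ContDiff ℝ ∞ (flatKc ρ) :=
  (contDiff_const.sub contDiff_flatM).add (contDiff_flatM.mul (contDiff_const.div (contDiff_flatD hρ)
    fun u ↦ (flatD_pos hρ u).ne'))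

/-- `contDiff_flatPt`. [folklore] -/
theorem contDiff_flatPt : ContDiff ℝ ∞ fun q : ℝ × ℝ ↦ flatPt ρ q.1 q.2 :=
  (contDiff_fst.add (contDiff_snd.mul ((contDiff_flatPc hρ).comp contDiff_fst))).prodMk
    (contDiff_snd.mul ((contDiff_flatKc hρ).comp contDiff_fst))

/-- On the flat sector `|3ρ - u₀| ≤ ρ tan(π/6)… ≤ ρ`: `q ≥ 1/√2`. We use the cruder sector
`|3ρ - u₀| ≤ ρ`, where `flatD ≤ √2 ρ` and `q ≥ 1/√2 ≥ 1/2`. [folklore] -/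
theorem half_le_flatQ {u₀ : ℝ} (h : |3 * ρ - u₀| ≤ ρ) : 1 / 2 ≤ flatQ ρ u₀ := by
  have hD := flatD_pos hρ u₀
  have hD2 : flatD ρ u₀ ≤ 2 * ρ := by
    rw [flatD, Real.sqrt_le_left (by linarith)]
    have := sq_abs (3 * ρ - u₀)
    have hab : |3 * ρ - u₀| ^ 2 ≤ ρ ^ 2 := pow_le_pow_left₀ (abs_nonneg _) h 2
    nlinarith
  rw [flatQ, le_div_iff₀ hD]; linarith

/-- **`k ≥ 1/2` on the sector `|3ρ - u₀| ≤ ρ`.** [folklore] -/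
theorem half_le_flatKc {u₀ : ℝ} (h : |3 * ρ - u₀| ≤ ρ) : 1 / 2 ≤ flatKc ρ u₀ := by
  have hm := flatM_mem (ρ := ρ) u₀
  have hq := half_le_flatQ hρ h
  rw [flatKc]; nlinarith [hm.1, hm.2]

/-- **Beyond `3ρ` the shell is the vertical family** `(u₀, a)`. [folklore] -/
theorem flatPt_of_ge {u₀ : ℝ} (h : 3 * ρ ≤ u₀) (a : ℝ) : flatPt ρ u₀ a = (u₀, a) := by
  rw [flatPt, flatPc, flatKc, flatM_of_ge hρ h]; simp

/-- **Within `5ρ/2` the shell is the radial shell of the bend**: for `-π/6 < ψ ≤ π/6` with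
`u₀ = 3ρ - ρ tan ψ ≤ 5ρ/2`, `flatPt u₀ a = bendPt ψ a`. [folklore] -/
theorem flatPt_eq_bendPt {ψ : ℝ} (h0 : -(π / 6) < ψ) (h1 : ψ ≤ π / 6) (hu : 3 * ρ - ρ * Real.tan ψ ≤ 5 * ρ / 2) (a : ℝ) :
    flatPt ρ (3 * ρ - ρ * Real.tan ψ) a = bendPt ρ ψ a := by
  have hc : 0 < Real.cos ψ := cos_pos_of_mem h0 (by linarith [Real.pi_pos])
  have hm : flatM ρ (3 * ρ - ρ * Real.tan ψ) = 1 := flatM_of_le hρ hu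
  have hD : flatD ρ (3 * ρ - ρ * Real.tan ψ) = ρ / Real.cos ψ := by
    rw [flatD, show 3 * ρ - (3 * ρ - ρ * Real.tan ψ) = ρ * Real.tan ψ by ring, Real.tan_eq_sin_div_cos]
    rw [show (ρ * (Real.sin ψ / Real.cos ψ)) ^ 2 + ρ ^ 2 = (ρ / Real.cos ψ) ^ 2 by
      have hc0 : Real.cos ψ ≠ 0 := hc.ne'
      field_simp
      linear_combination Real.sin_sq_add_cos_sq ψ]
    exact Real.sqrt_sq (div_pos hρ hc).le
  rw [bendPt_of_le h0 h1, flatPt, flatPc, flatKc, flatP, flatQ, hm, hD, Real.tan_eq_sin_div_cos]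
  refine Prod.ext ?_ ?_ <;> simp only <;> field_simp <;> ring

/-- **Injectivity of the shell over the flat sector** for small displacement: there is `δ > 0`
with `(u₀, a) ↦ flatPt u₀ a` injective on `[2ρ, 4ρ] × [-δ, δ]`. [folklore] -/
theorem exists_injOn_flatPt : ∃ δ > 0, InjOn (fun q : ℝ × ℝ ↦ flatPt ρ q.1 q.2) (Icc (2 * ρ) (4 * ρ) ×ˢ Icc (-δ) δ) := by
  have h := exists_injOn_interp (p := flatPc ρ) (k := flatKc ρ) (a := 2 * ρ) (b := 4 * ρ) (k₀ := 1 / 2)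
    (by norm_num) (fun x _ ↦ (contDiff_flatPc hρ).contDiffAt.of_le (by norm_num))
    (fun x _ ↦ (contDiff_flatKc hρ).contDiffAt.of_le (by norm_num))
    (fun x hx ↦ half_le_flatKc hρ (abs_le.2 ⟨by linarith [hx.2], by linarith [hx.1]⟩))
  simpa [flatPt] using h

end Flat

/-! ### The foot of the cylinder: from radial to horizontal displacement over the left line -/

section Foot

variable (ρ : ℝ)

/-- The interpolation bump of the foot: `1` for `y ≤ 3ρ/2` (radial), `0` for `y ≥ 2ρ` (horizontal). [folklore] -/
def footM (y : ℝ) : ℝ := 1 - Real.smoothTransition ((y - 3 * ρ / 2) / (ρ / 2))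

/-- The distance from `(2ρ, y)` to `C`. [folklore] -/
def footD (y : ℝ) : ℝ := Real.sqrt (ρ ^ 2 + (ρ - y) ^ 2)

/-- The horizontal displacement coefficient `(1 - m) + m ρ / D`. [folklore] -/
def footKc (y : ℝ) : ℝ := (1 - footM ρ y) + footM ρ y * (ρ / footD ρ y)

/-- The vertical displacement coefficient `m (ρ - y) / D`. [folklore] -/
def footPc (y : ℝ) : ℝ := footM ρ y * ((ρ - y) / footD ρ y)

/-- **The shell over the foot of the cylinder**: `(2ρ + a k, y + a p)`. [folklore] -/
def footPt (y a : ℝ) : ℝ × ℝ := (2 * ρ + a * footKc ρ y, y + a * footPc ρ y)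

variable {ρ} (hρ : 0 < ρ)

/-- `footM_of_le`. [folklore] -/
theorem footM_of_le {y : ℝ} (h : y ≤ 3 * ρ / 2) (hρ : 0 < ρ) : footM ρ y = 1 := by
  rw [footM, Real.smoothTransition.zero_of_nonpos (div_nonpos_of_nonpos_of_nonneg (by linarith) (by linarith)),
    sub_zero]

/-- `footM_of_ge`. [folklore] -/
theorem footM_of_ge {y : ℝ} (h : 2 * ρ ≤ y) (hρ : 0 < ρ) : footM ρ y = 0 := by
  rw [footM, Real.smoothTransition.one_of_one_le (by rw [le_div_iff₀ (by linarith)]; linarith), sub_self]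

/-- `footM_mem`. [folklore] -/
theorem footM_mem (y : ℝ) : footM ρ y ∈ Icc (0 : ℝ) 1 := by
  constructor
  · rw [footM]; linarith [Real.smoothTransition.le_one ((y - 3 * ρ / 2) / (ρ / 2))]
  · rw [footM]; linarith [Real.smoothTransition.nonneg ((y - 3 * ρ / 2) / (ρ / 2))]

/-- `contDiff_footM`. [folklore] -/
theorem contDiff_footM : ContDiff ℝ ∞ (footM ρ) :=
  contDiff_const.sub (Real.smoothTransition.contDiff.comp ((contDiff_id.sub contDiff_const).div_const _))

include hρ

/-- `footD_pos`. [folklore] -/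
theorem footD_pos (y : ℝ) : 0 < footD ρ y := Real.sqrt_pos.2 (by positivity)

/-- `contDiff_footD`. [folklore] -/
theorem contDiff_footD : ContDiff ℝ ∞ (footD ρ) :=
  (contDiff_const.add ((contDiff_const.sub contDiff_id).pow 2)).sqrt fun y ↦ by positivity

/-- `contDiff_footKc`. [folklore] -/
theorem contDiff_footKc : ContDiff ℝ ∞ (footKc ρ) :=
  (contDiff_const.sub contDiff_footM).add (contDiff_footM.mul (contDiff_const.div (contDiff_footD hρ)
    fun y ↦ (footD_pos hρ y).ne'))

/-- `contDiff_footPc`. [folklore] -/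
theorem contDiff_footPc : ContDiff ℝ ∞ (footPc ρ) :=
  contDiff_footM.mul ((contDiff_const.sub contDiff_id).div (contDiff_footD hρ) fun y ↦ (footD_pos hρ y).ne')

/-- `contDiff_footPt`. [folklore] -/
theorem contDiff_footPt : ContDiff ℝ ∞ fun q : ℝ × ℝ ↦ footPt ρ q.1 q.2 :=
  (contDiff_const.add (contDiff_snd.mul ((contDiff_footKc hρ).comp contDiff_fst))).prodMk
    (contDiff_fst.add (contDiff_snd.mul ((contDiff_footPc hρ).comp contDiff_fst)))

/-- **`k ≥ 1/2`** on `|ρ - y| ≤ ρ` (`D ≤ √2 ρ ≤ 2ρ`). [folklore] -/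
theorem half_le_footKc {y : ℝ} (h : |ρ - y| ≤ ρ) : 1 / 2 ≤ footKc ρ y := by
  have hm := footM_mem (ρ := ρ) y
  have hD := footD_pos hρ y
  have hD2 : footD ρ y ≤ 2 * ρ := by
    rw [footD, Real.sqrt_le_left (by linarith)]
    have := sq_abs (ρ - y)
    have hab : |ρ - y| ^ 2 ≤ ρ ^ 2 := pow_le_pow_left₀ (abs_nonneg _) h 2
    nlinarith
  have hq : 1 / 2 ≤ ρ / footD ρ y := by rw [le_div_iff₀ hD]; linarith
  rw [footKc]; nlinarith [hm.1, hm.2]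

/-- **Above `2ρ` the shell is the horizontal family** `(2ρ + a, y)`. [folklore] -/
theorem footPt_of_ge {y : ℝ} (h : 2 * ρ ≤ y) (a : ℝ) : footPt ρ y a = (2 * ρ + a, y) := by
  rw [footPt, footKc, footPc, footM_of_ge h hρ]; simp

/-- **Below `3ρ/2` the shell is the radial shell of the bend**: for `π/3 ≤ ψ < 2π/3` with
`y = ρ - ρ cos ψ / sin ψ ≤ 3ρ/2`, `footPt y a = bendPt ψ a`. [folklore] -/
theorem footPt_eq_bendPt {ψ : ℝ} (h1 : π / 3 ≤ ψ) (h2 : ψ < 2 * π / 3)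
    (hy : ρ - ρ * (Real.cos ψ / Real.sin ψ) ≤ 3 * ρ / 2) (a : ℝ) :
    footPt ρ (ρ - ρ * (Real.cos ψ / Real.sin ψ)) a = bendPt ρ ψ a := by
  have hs : 0 < Real.sin ψ := sin_pos_of_mem (by linarith [Real.pi_pos]) h2
  have hm : footM ρ (ρ - ρ * (Real.cos ψ / Real.sin ψ)) = 1 := footM_of_le hy hρ
  have hD : footD ρ (ρ - ρ * (Real.cos ψ / Real.sin ψ)) = ρ / Real.sin ψ := by
    rw [footD, show ρ - (ρ - ρ * (Real.cos ψ / Real.sin ψ)) = ρ * (Real.cos ψ / Real.sin ψ) by ring]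
    rw [show ρ ^ 2 + (ρ * (Real.cos ψ / Real.sin ψ)) ^ 2 = (ρ / Real.sin ψ) ^ 2 by
      have hs0 : Real.sin ψ ≠ 0 := hs.ne'
      field_simp
      linear_combination Real.sin_sq_add_cos_sq ψ]
    exact Real.sqrt_sq (div_pos hρ hs).le
  rw [bendPt_of_ge h1 h2, footPt, footKc, footPc, hm, hD]
  refine Prod.ext ?_ ?_ <;> simp only <;> field_simp <;> ring

/-- **Injectivity of the shell over the foot** for small displacement: there is `δ > 0` with
`(y, a) ↦ footPt y a` injective on `[ρ, 2ρ + L] × [-δ, δ]`… we record it on `[ρ, 2ρ]`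
extended: on `[ρ + ρ/5, 4ρ] × [-δ, δ]`. [folklore] -/
theorem exists_injOn_footPt : ∃ δ > 0, InjOn (fun q : ℝ × ℝ ↦ footPt ρ q.1 q.2) (Icc (6 * ρ / 5) (4 * ρ) ×ˢ Icc (-δ) δ) := by
  -- swap the roles of the coordinates: `(y, a) ↦ (y + a p, a k)` then add `2ρ` to the first… we
  -- apply the interpolation lemma to `(y, a) ↦ (y + a p(y), a k(y))` and transport.
  have hk : ∀ x ∈ Icc (6 * ρ / 5) (4 * ρ), 1 / 2 ≤ footKc ρ x := fun x hx ↦ by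
    rcases le_or_gt x (2 * ρ) with hle | hgt
    · exact half_le_footKc hρ (abs_le.2 ⟨by linarith, by linarith [hx.1]⟩)
    · rw [footKc, footM_of_ge hgt.le hρ]; norm_num
  obtain ⟨δ, hδ, hinj⟩ := exists_injOn_interp (p := footPc ρ) (k := footKc ρ) (a := 6 * ρ / 5) (b := 4 * ρ)
    (k₀ := 1 / 2) (by norm_num) (fun x _ ↦ (contDiff_footPc hρ).contDiffAt.of_le (by norm_num))
    (fun x _ ↦ (contDiff_footKc hρ).contDiffAt.of_le (by norm_num)) hk
  refine ⟨δ, hδ, fun q hq q' hq' h ↦ ?_⟩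
  simp only [footPt, Prod.mk.injEq] at h
  exact hinj hq hq' (by rw [Prod.mk.injEq]; exact ⟨h.2, by linarith [h.1]⟩)

end Foot

end Literature.Topology.FourManifolds
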